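import Summits.AnomalousDissipation.AnomalousDissipation.Theses.TwoAndHalfD
import Literature.Analysis.FluidPDE.ScalarTransportDuality
import Literature.Analysis.FluidPDE.PassiveScalarWellPosednessProofs
import Literature.Analysis.FluidPDE.PassiveScalarClassicalWeak
import Literature.Analysis.FluidPDE.TorusHeatForcedIcc
import Summits.AnomalousDissipation.AnomalousDissipation.Theorems.TwoAndHalfDScalarAnomalySteadySourceFormalColdStartVarianceToolkit
import Summits.AnomalousDissipation.AnomalousDissipation.Theorems.TwoAndHalfDScalarAnomalySteadySourceFormalColdStartVariance

/-!
# D0 `stub_weakDuhamel`: the weak Duhamel identity by forward–backward duality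

Stub D0 of the line `Sketch` (duhamel-release) for the crux
`Summit.AnomalousDissipation.AnomalousDissipation.Theses.TwoAndHalfD.TwohalfdThesis`
(stmt-AnomalousDissipation-0206); the statement is registered verbatim in the line's checked
skeleton and is consumed by the kernel-checked composition `TwohalfdThesis_of` there.

CONTENT. Let `κ > 0`, let `θ` be a classical solution of the sourced advection–diffusion equation
`∂ₜθ + u·∇θ = κΔθ + h` on `[0, ∞) × T²` with the cold start `θ(0) = 0`, and for every release
time `s ≥ 0` let `φ s` be a classical solution of the UNFORCED equation on `[s, ∞)` with
`φ s s = h`. Then for every smooth `χ` and every `t ≥ 0`,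

  `∫ θ(t) χ = ∫₀ᵗ (∫ φ s (t) χ) ds`     (`stub_weakDuhamel`).

PROOF (duality; no differentiation under the `ds`-integral, no joint regularity in `(s, t)`).
Fix `t > 0` and solve the REVERSED problem `∂_σ χ̃ - u(t - σ)·∇χ̃ = κΔχ̃`, `χ̃(0) = χ` on `[0, t]`
by the tree's existence theorem (`Torus.exists_isClassicalScalarTransportForcedOn`, source `0`;
the reversed drift is smooth and divergence free, `Torus.isSmoothSpaceTimeOn_reverse_neg`,
`Torus.isDivFree_reverse`).

* `integral_mul_eq_of_reverse_forced` — the one-term FORCED twin of the tree's duality identity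
  `IsClassicalScalarTransportOn.integral_mul_eq_of_reverse`: the pairing `σ ↦ ∫ θ(σ) χ̃(t - σ)`
  has derivative `∫ h χ̃(t - σ)` within `[0, t]` (Green's identity and `div u = 0` kill the other
  terms), whence by the fundamental theorem of calculus
  `∫ θ(t) χ̃(0) = ∫ θ(0) χ̃(t) + ∫₀ᵗ ∫ h χ̃(t - σ) dσ`; with `θ(0) = 0`, `χ̃(0) = χ` this is
  `∫ θ(t) χ = ∫₀ᵗ ∫ h χ̃(t - σ) dσ`.
* `integral_mul_eq_of_reverse_shifted` — the UNFORCED duality for a release on `[s, t]`, `s < t`: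
  after the time shift `σ ↦ σ + s` (`isClassicalScalarTransportOn_comp_add_const`) the reversed
  drift of the shifted problem on `[0, t - s]` is again `σ ↦ -u(t - σ)`, so the SAME `χ̃`
  (restricted to `[0, t - s]`) gives `∫ φ s (t) χ̃(0) = ∫ φ s (s) χ̃(t - s)`, i.e.
  `∫ φ s (t) χ = ∫ h χ̃(t - s)`.

Comparing the two integrands on `[0, t]` (at `s = t` both are `∫ h χ`) proves the identity.
Supports stmt-AnomalousDissipation-0206. [folklore: Evans 2010, §7.1.1 (adjoint problem);
Duhamel's principle, Evans 2010, §2.3.1 (c)]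
-/

noncomputable section

-- the summit path `AnomalousDissipation/AnomalousDissipation` duplicates a namespace component
set_option linter.dupNamespace false

namespace Summit.AnomalousDissipation.AnomalousDissipation.Theorems.TwohalfdThesis

open MeasureTheory Set Filter Topology
open scoped ENNReal NNReal InnerProductSpace
open Literature.Analysis.FunctionSpaces Literature.Analysis.FluidPDE

variable {d : Type*} [Fintype d] [DecidableEq d]

/-! ## Classical solutions: forced with zero source, time shifts -/

/-- A classical solution of the forced equation with the zero source is a classical solution of
the unforced equation (the field-wise identity; cf.
`Torus.isClassicalScalarTransportForcedOn_zero_iff`). [folklore] -/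
theorem isClassicalScalarTransportOn_of_forced_zero {S : Set ℝ} {κ : ℝ}
    {u : ℝ → UnitAddTorus d → EuclideanSpace ℝ d} {θ : ℝ → UnitAddTorus d → ℝ}
    (h : Torus.IsClassicalScalarTransportForcedOn S κ u (fun (_ : ℝ) (_ : UnitAddTorus d) => (0 : ℝ)) θ) :
    Torus.IsClassicalScalarTransportOn S κ u θ :=
  ⟨h.smooth_velocity, h.smooth_scalar, fun t ht x => by simpa using h.transport t ht x, h.divFree⟩

/-- **Time shift of classical solutions.** If `φ` solves `∂ₜφ + u·∇φ = κΔφ` classically on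
`S × T^d`, then `σ ↦ φ (σ + c)` solves the equation with the shifted drift `σ ↦ u (σ + c)` on
`((· + c)⁻¹' S) × T^d` (joint smoothness: `IsSmoothSpaceTimeOn.comp_add_const`; one-sided time
derivative: `Torus.timeDerivWithin_comp_add_const`). [folklore] -/
theorem isClassicalScalarTransportOn_comp_add_const {S : Set ℝ} {κ : ℝ}
    {u : ℝ → UnitAddTorus d → EuclideanSpace ℝ d} {φ : ℝ → UnitAddTorus d → ℝ}
    (h : Torus.IsClassicalScalarTransportOn S κ u φ) (c : ℝ) :
    Torus.IsClassicalScalarTransportOn ((· + c) ⁻¹' S) κ (fun σ => u (σ + c))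
      (fun σ => φ (σ + c)) where
  smooth_velocity := h.smooth_velocity.comp_add_const c
  smooth_scalar := h.smooth_scalar.comp_add_const c
  transport σ hσ x := by
    rw [Torus.timeDerivWithin_comp_add_const]
    exact h.transport (σ + c) hσ x
  divFree σ hσ := h.divFree (σ + c) hσ

/-! ## Forced duality on `[0, τ]` -/

/-- **Forced forward–backward duality** (one-term forced twin of
`IsClassicalScalarTransportOn.integral_mul_eq_of_reverse`; Evans 2010, §7.1.1: the adjoint of
`-κΔ + v·∇`, `div v = 0`, is `-κΔ - v·∇`). If `θ` solves `∂ₜθ + v·∇θ = κΔθ + h` on `[0, τ]`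
with a steady smooth source `h`, and `χ` solves the unforced equation with the reversed drift
`v'(σ) = -v(τ - σ)` on `[0, τ]`, then the pairing `t ↦ ∫ θ(t) χ(τ - t)` has derivative
`∫ h χ(τ - t)` within `[0, τ]` (`∫ (Δθ)ψ = ∫ θ Δψ`, `∫ θ v·∇ψ + ∫ (v·∇θ) ψ = 0`), whence by the
fundamental theorem of calculus
`∫ θ(τ) χ(0) = ∫ θ(0) χ(τ) + ∫₀^τ (∫ h χ(τ - σ)) dσ`. [folklore] -/
theorem integral_mul_eq_of_reverse_forced {κ τ : ℝ} {v v' : ℝ → UnitAddTorus d → EuclideanSpace ℝ d}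
    {hsrc : UnitAddTorus d → ℝ} {θ χ : ℝ → UnitAddTorus d → ℝ} (hτ : 0 < τ)
    (hθ : Torus.IsClassicalScalarTransportForcedOn (Icc 0 τ) κ v (fun _ => hsrc) θ)
    (hχ : Torus.IsClassicalScalarTransportOn (Icc 0 τ) κ v' χ)
    (hrel : ∀ σ ∈ Icc 0 τ, ∀ x, v' σ x = -v (τ - σ) x) :
    ∫ x, θ τ x * χ 0 x = (∫ x, θ 0 x * χ τ x) + ∫ σ in (0 : ℝ)..τ, ∫ x, hsrc x * χ (τ - σ) x := by
  have hU : UniqueDiffOn ℝ (Icc 0 τ) := uniqueDiffOn_Icc hτ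
  have hθs := hθ.smooth_scalar
  have hh : Torus.IsSmooth hsrc := hθ.smooth_source.isSmooth_slice (left_mem_Icc.2 hτ.le)
  -- the reversed field, the pairing and its derivative
  have hχrs : Torus.IsSmoothSpaceTimeOn (Icc 0 τ) (fun t x => χ (τ - t) x) :=
    Torus.IsSmoothSpaceTimeOn.reverse hχ.smooth_scalar
  have hΦ : Torus.IsSmoothSpaceTimeOn (Icc 0 τ) (fun t x => θ t x * χ (τ - t) x) := hθs.mul hχrs
  have hΨ : Torus.IsSmoothSpaceTimeOn (Icc 0 τ) (fun t x => hsrc x * χ (τ - t) x) :=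
    (Torus.isSmoothSpaceTimeOn_const hh _).mul hχrs
  -- the derivative of the pairing is the source pairing
  have hderiv : ∀ t ∈ Icc 0 τ, HasDerivWithinAt (fun t => ∫ x, θ t x * χ (τ - t) x)
      (∫ x, hsrc x * χ (τ - t) x) (Icc 0 τ) t := by
    intro t ht
    have hmem : τ - t ∈ Icc 0 τ := ⟨by linarith [ht.2], by linarith [ht.1]⟩
    have hθt : Torus.IsSmooth (θ t) := hθs.isSmooth_slice ht
    have hχt : Torus.IsSmooth (χ (τ - t)) := hχrs.isSmooth_slice ht
    have hvt : Torus.IsSmooth (v t) := hθ.smooth_velocity.isSmooth_slice ht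
    have hE := hΦ.hasDerivWithinAt_integral (convex_Icc 0 τ) ht
    -- pointwise: the time derivative of the integrand
    have hpt : ∀ x, Torus.timeDerivWithin (Icc 0 τ) (fun t x => θ t x * χ (τ - t) x) t x =
        κ * (Torus.laplacian (θ t) x * χ (τ - t) x - θ t x * Torus.laplacian (χ (τ - t)) x) -
          (θ t x * ⟪v t x, Torus.gradient (χ (τ - t)) x⟫_ℝ +
            ⟪v t x, Torus.gradient (θ t) x⟫_ℝ * χ (τ - t) x) +
          hsrc x * χ (τ - t) x := by
      intro x
      have h1 := hθs.hasDerivWithinAt_slice ht x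
      have h2 := hχrs.hasDerivWithinAt_slice ht x
      have h12 : HasDerivWithinAt (fun s => θ s x * χ (τ - s) x)
          (Torus.timeDerivWithin (Icc 0 τ) θ t x * χ (τ - t) x +
            θ t x * Torus.timeDerivWithin (Icc 0 τ) (fun t x => χ (τ - t) x) t x) (Icc 0 τ) t :=
        h1.mul h2
      have hprod : Torus.timeDerivWithin (Icc 0 τ) (fun t x => θ t x * χ (τ - t) x) t x =
          Torus.timeDerivWithin (Icc 0 τ) θ t x * χ (τ - t) x +
            θ t x * Torus.timeDerivWithin (Icc 0 τ) (fun t x => χ (τ - t) x) t x := by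
        rw [Torus.timeDerivWithin, h12.derivWithin (hU t ht)]
      have hdθ : Torus.timeDerivWithin (Icc 0 τ) θ t x =
          κ * Torus.laplacian (θ t) x - ⟪v t x, Torus.gradient (θ t) x⟫_ℝ + hsrc x := by
        have e := hθ.transport t ht x
        linarith
      have hdχ : Torus.timeDerivWithin (Icc 0 τ) (fun t x => χ (τ - t) x) t x =
          -(κ * Torus.laplacian (χ (τ - t)) x) - ⟪v t x, Torus.gradient (χ (τ - t)) x⟫_ℝ := by
        have e1 : Torus.timeDerivWithin (Icc 0 τ) (fun t x => χ (τ - t) x) t x =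
            -Torus.timeDerivWithin (Icc 0 τ) χ (τ - t) x :=
          Torus.timeDerivWithin_reverse hτ hχ.smooth_scalar ht x
        have e2 := hχ.transport (τ - t) hmem x
        have e3 : v' (τ - t) x = -v t x := by rw [hrel (τ - t) hmem x, sub_sub_cancel]
        rw [e3, inner_neg_left] at e2
        have e4 : Torus.timeDerivWithin (Icc 0 τ) χ (τ - t) x =
            κ * Torus.laplacian (χ (τ - t)) x + ⟪v t x, Torus.gradient (χ (τ - t)) x⟫_ℝ := by
          linarith
        rw [e1, e4]
        ring
      rw [hprod, hdθ, hdχ]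
      ring
    -- integrate: Green's identity and the transport identity; the source pairing survives
    have hval : ∫ x, Torus.timeDerivWithin (Icc 0 τ) (fun t x => θ t x * χ (τ - t) x) t x =
        ∫ x, hsrc x * χ (τ - t) x := by
      have i1 : Integrable (fun x => Torus.laplacian (θ t) x * χ (τ - t) x) volume :=
        (hθt.laplacian.smul' hχt).integrable
      have i2 : Integrable (fun x => θ t x * Torus.laplacian (χ (τ - t)) x) volume :=
        (hθt.smul' hχt.laplacian).integrable
      have i3 : Integrable (fun x => θ t x * ⟪v t x, Torus.gradient (χ (τ - t)) x⟫_ℝ) volume :=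
        (hθt.smul' (hvt.inner hχt.gradient)).integrable
      have i4 : Integrable (fun x => ⟪v t x, Torus.gradient (θ t) x⟫_ℝ * χ (τ - t) x) volume :=
        ((hvt.inner hθt.gradient).smul' hχt).integrable
      have i5 : Integrable (fun x => hsrc x * χ (τ - t) x) volume := (hh.smul' hχt).integrable
      have i12 : Integrable (fun x => κ * (Torus.laplacian (θ t) x * χ (τ - t) x -
          θ t x * Torus.laplacian (χ (τ - t)) x)) volume := (i1.sub' i2).const_mul κ
      have i34 : Integrable (fun x => θ t x * ⟪v t x, Torus.gradient (χ (τ - t)) x⟫_ℝ +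
          ⟪v t x, Torus.gradient (θ t) x⟫_ℝ * χ (τ - t) x) volume := i3.fun_add i4
      simp_rw [hpt]
      rw [integral_add (i12.sub' i34) i5, integral_sub i12 i34, integral_const_mul,
        integral_sub i1 i2, integral_add i3 i4,
        Torus.integral_mul_inner_gradient_add_eq_zero hvt (hθ.divFree t ht) hθt hχt,
        Torus.integral_mul_laplacian_comm_holds hθt hχt, sub_self, mul_zero, sub_zero, zero_add]
    rw [hval] at hE
    exact hE
  -- the fundamental theorem of calculus on `[0, τ]`
  have hcont : ContinuousOn (fun t => ∫ x, θ t x * χ (τ - t) x) (Icc 0 τ) :=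
    hΦ.continuousOn_integral (convex_Icc 0 τ)
  have hGc : ContinuousOn (fun t => ∫ x, hsrc x * χ (τ - t) x) (Icc 0 τ) :=
    hΨ.continuousOn_integral (convex_Icc 0 τ)
  have hGi : IntervalIntegrable (fun t => ∫ x, hsrc x * χ (τ - t) x) volume 0 τ :=
    (hGc.mono (uIcc_of_le hτ.le).subset).intervalIntegrable
  have hFTC : ∫ σ in (0 : ℝ)..τ, (∫ x, hsrc x * χ (τ - σ) x) =
      (∫ x, θ τ x * χ (τ - τ) x) - ∫ x, θ 0 x * χ (τ - 0) x :=
    intervalIntegral.integral_eq_sub_of_hasDerivAt_of_le hτ.le hcont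
      (fun σ hσ => (hderiv σ (Ioo_subset_Icc_self hσ)).hasDerivAt (Icc_mem_nhds hσ.1 hσ.2)) hGi
  rw [sub_self, sub_zero] at hFTC
  linarith

/-! ## Unforced duality for a release on `[s, t]` -/

/-- **Duality for a release.** If `φ` solves `∂ₜφ + u·∇φ = κΔφ` classically on `[s, t]`,
`s < t`, and `χ̃` solves the equation with the reversed drift `σ ↦ -u(t - σ)` on `[0, t - s]`,
then `∫ φ(t) χ̃(0) = ∫ φ(s) χ̃(t - s)`: shift `φ` to `[0, t - s]`
(`isClassicalScalarTransportOn_comp_add_const`), where the reversed drift of the shifted problem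
is `σ ↦ -u(t - s - σ + s) = -u(t - σ)`, and apply the tree's duality identity
`IsClassicalScalarTransportOn.integral_mul_eq_of_reverse`. [folklore] -/
theorem integral_mul_eq_of_reverse_shifted {κ s t : ℝ} {u : ℝ → UnitAddTorus d → EuclideanSpace ℝ d}
    {φ χt : ℝ → UnitAddTorus d → ℝ} (hst : s < t)
    (hφ : Torus.IsClassicalScalarTransportOn (Icc s t) κ u φ)
    (hχ : Torus.IsClassicalScalarTransportOn (Icc 0 (t - s)) κ (fun σ x => -u (t - σ) x) χt) :
    ∫ x, φ t x * χt 0 x = ∫ x, φ s x * χt (t - s) x := by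
  have hτ : 0 < t - s := sub_pos.2 hst
  have hφ' := isClassicalScalarTransportOn_comp_add_const hφ s
  rw [Torus.preimage_add_const_Icc', sub_self] at hφ'
  have h := hφ'.integral_mul_eq_of_reverse hτ hχ (fun σ _ x => by
    rw [show t - s - σ + s = t - σ by ring])
  simp only [sub_add_cancel, zero_add] at h
  exact h

/-! ## The stub: weak Duhamel by duality -/

/-- **D0 `stub_weakDuhamel` (line `Sketch` = duhamel-release, crux `TwoAndHalfD.TwohalfdThesis`).**
Let `κ > 0`, `θ` the classical solution of `∂ₜθ + u·∇θ = κΔθ + h` on `[0, ∞) × T²` with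
`θ(0) = 0` (its drift `u` is jointly smooth and divergence free on `[0, ∞)` by the structure), and
for every `s ≥ 0` let `φ s` be a classical solution of the UNFORCED equation on `[s, ∞)` with
`φ s s = h`. Then for every smooth `χ` and every `t ≥ 0`, `∫ θ(t) χ = ∫₀ᵗ (∫ φ s (t) χ) ds`.
Proof: at `t = 0` both sides vanish; for `t > 0` solve the reversed problem
`∂_σχ̃ - u(t - σ)·∇χ̃ = κΔχ̃`, `χ̃(0) = χ` on `[0, t]`
(`Torus.exists_isClassicalScalarTransportForcedOn` with source `0`,
`Torus.isSmoothSpaceTimeOn_reverse_neg`, `Torus.isDivFree_reverse`); the forced duality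
`integral_mul_eq_of_reverse_forced` gives `∫ θ(t) χ = ∫₀ᵗ ∫ h χ̃(t - σ) dσ` and the release
duality `integral_mul_eq_of_reverse_shifted` gives `∫ φ s (t) χ = ∫ h χ̃(t - s)` for
`0 ≤ s < t` (at `s = t` both integrands are `∫ h χ`). [folklore] -/
theorem stub_weakDuhamel : ∀ (κ : ℝ) (u : ℝ → (UnitAddTorus (Fin 2)) → (EuclideanSpace ℝ (Fin 2))) (h : (UnitAddTorus (Fin 2)) → ℝ) (θ : ℝ → (UnitAddTorus (Fin 2)) → ℝ) (φ : ℝ → ℝ → (UnitAddTorus (Fin 2)) → ℝ), 0 < κ → Torus.IsSmooth h → Torus.IsClassicalScalarTransportForcedOn (Ici 0) κ u (fun _ => h) θ → θ 0 = (fun _ => (0 : ℝ)) → (∀ s, 0 ≤ s → Torus.IsClassicalScalarTransportOn (Ici s) κ u (φ s) ∧ φ s s = h) → ∀ χ : (UnitAddTorus (Fin 2)) → ℝ, Torus.IsSmooth χ → ∀ t, 0 ≤ t → ∫ x, θ t x * χ x = ∫ s in (0 : ℝ)..t, ∫ x, φ s t x * χ x := by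
  intro κ u h θ φ hκ _ hθ hθ0 hφ χ hχ t ht
  rcases eq_or_lt_of_le ht with rfl | htpos
  · simp [hθ0]
  -- (1) the reversed problem on `[0, t]`
  have hu : Torus.IsSmoothSpaceTimeOn (Icc 0 t) u := hθ.smooth_velocity.mono Icc_subset_Ici_self
  have hdiv : ∀ σ ∈ Icc 0 t, Torus.IsDivFree (u σ) := fun σ hσ =>
    hθ.divFree σ (Icc_subset_Ici_self hσ)
  have h0 : Torus.IsSmoothSpaceTimeOn (Icc 0 t) (fun (_ : ℝ) (_ : UnitAddTorus (Fin 2)) => (0 : ℝ)) :=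
    Torus.isSmoothSpaceTimeOn_const (Torus.isSmooth_const _) _
  obtain ⟨χt, hχt', hχt0⟩ := Torus.exists_isClassicalScalarTransportForcedOn hκ htpos
    (Torus.isSmoothSpaceTimeOn_reverse_neg hu) (Torus.isDivFree_reverse hdiv) h0 hχ
  have hχt : Torus.IsClassicalScalarTransportOn (Icc 0 t) κ (fun σ x => -u (t - σ) x) χt :=
    isClassicalScalarTransportOn_of_forced_zero hχt'
  -- (2) forced duality: `∫ θ(t) χ = ∫₀ᵗ ∫ h χ̃(t - σ) dσ`
  have hθ' : Torus.IsClassicalScalarTransportForcedOn (Icc 0 t) κ u (fun _ => h) θ :=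
    ScalarAnomalySteadySourceFormal.ColdStartVariance.forced_restrict hθ Icc_subset_Ici_self
      (uniqueDiffOn_Icc htpos)
  have hD := integral_mul_eq_of_reverse_forced htpos hθ' hχt (fun _ _ _ => rfl)
  have hz : ∫ x, θ 0 x * χt t x = 0 := by simp [hθ0]
  rw [hχt0, hz, zero_add] at hD
  rw [hD]
  -- (3)-(4) release duality for `0 ≤ s < t`, and the endpoint `s = t`
  refine intervalIntegral.integral_congr fun s hs => ?_
  rw [uIcc_of_le ht] at hs
  rcases eq_or_lt_of_le hs.2 with hst | hst
  · rw [hst, sub_self, hχt0, (hφ t ht).2]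
  · have hφs : Torus.IsClassicalScalarTransportOn (Icc s t) κ u (φ s) :=
      ((hφ s hs.1).1).restrict_Icc hst Icc_subset_Ici_self
    have hχs : Torus.IsClassicalScalarTransportOn (Icc 0 (t - s)) κ (fun σ x => -u (t - σ) x) χt :=
      hχt.restrict_Icc (sub_pos.2 hst) (Icc_subset_Icc le_rfl (sub_le_self t hs.1))
    have e := integral_mul_eq_of_reverse_shifted hst hφs hχs
    rw [hχt0, (hφ s hs.1).2] at e
    exact e.symm

end Summit.AnomalousDissipation.AnomalousDissipation.Theorems.TwohalfdThesis

end
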